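import Literature.Computability.AlgebraicComplexity.QuantumFunctionalsUpperEqLower
import Literature.Computability.AlgebraicComplexity.QuantumFunctionalsUpperSubmultiplicativeProofs
import HarnessLib

/-!
# Multiplicativity of the quantum functionals (CVZ Cor. 3.31): discharge of
# `ChristandlVranaZuiddam2023_kronecker_le` and `ChristandlVranaZuiddam2023_kronecker`

Topic `Literature/Computability/AlgebraicComplexity`; proofs file (theorems only) closing the named
facts `ChristandlVranaZuiddam2023_kronecker_le` (`QuantumFunctionalsKroneckerFacts.lean`: the `≤` half
of Cor. 3.31, `F_θ(s ⊗ t) ≤ F_θ(s) F_θ(t)`) and `ChristandlVranaZuiddam2023_kronecker`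
(`QuantumFunctionals.lean`: `F_θ(s ⊗ t) = F_θ(s) F_θ(t)`) of M. Christandl, P. Vrana, J. Zuiddam,
*Universal points in the asymptotic spectrum of tensors*, J. Amer. Math. Soc. 36 (2023) 31–79
= arXiv:1709.07851v3, Cor. 3.31 (p. 16), for every `θ ∈ P([3])` (the case `k = 3`, where
`P_s(B) = P([3])`) and all complex 3-tensors `s`, `t`.

The printed proof is now entirely in the tree, and this file only assembles it:

* `F_θ(s ⊗ t) ≥ F_θ(s) F_θ(t)` — Lemma 3.23 = Thm. 3.19.3: `ChristandlVranaZuiddam2023_kronecker_ge`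
  (`QuantumFunctionalsKronecker.lean`);
* `F^θ(s ⊗ t) ≤ F^θ(s) F^θ(t)` for the upper functional of Def. 3.3 — Lemma 3.13:
  `ChristandlVranaZuiddam2023_upper_submultiplicative_holds`
  (`QuantumFunctionalsUpperSubmultiplicativeProofs.lean`);
* `E^θ = E_θ` — Thm. 3.30 (Thm. 3.24, Keyl–Werner, and Thm. 3.29, entanglement polytopes):
  `ChristandlVranaZuiddam2023_upper_eq_lower_holds` (`QuantumFunctionalsUpperEqLower.lean`);
* the reductions `ChristandlVranaZuiddam2023_kronecker_le_of_upper` and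
  `ChristandlVranaZuiddam2023_kronecker_of_upper` (`QuantumFunctionalsUpper.lean`), the latter through
  `ChristandlVranaZuiddam2023_kronecker_of_le` (`QuantumFunctionalsKroneckerFacts.lean`).

No definitions, no named facts.

## References

* M. Christandl, P. Vrana, J. Zuiddam, J. Amer. Math. Soc. 36 (2023) 31–79 = arXiv:1709.07851v3,
  Lemma 3.13 (p. 14), Lemma 3.23 (p. 15), Thm. 3.24 (p. 15), Thm. 3.30 and Cor. 3.31 (p. 16).
  [ChristandlVranaZuiddam2023]
-/

noncomputable section

namespace Literature.Computability.AlgebraicComplexity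

universe u

/-- **Discharge of `ChristandlVranaZuiddam2023_kronecker_le`** (the `≤` half of CVZ Cor. 3.31, `k = 3`):
`F_θ(s ⊗ t) ≤ F_θ(s) F_θ(t)` for every `θ ∈ P([3])` and all complex 3-tensors `s, t` — Lemma 3.13 for
the upper functional together with `F^θ = F_θ` (Thm. 3.30).
[cite: ChristandlVranaZuiddam2023, Cor. 3.31 (with Lemma 3.13 and Thm. 3.30)] -/
theorem ChristandlVranaZuiddam2023_kronecker_le_holds : ChristandlVranaZuiddam2023_kronecker_le.{u} :=
  ChristandlVranaZuiddam2023_kronecker_le_of_upper ChristandlVranaZuiddam2023_upper_submultiplicative_holds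
    ChristandlVranaZuiddam2023_upper_eq_lower_holds

/-- **Discharge of `ChristandlVranaZuiddam2023_kronecker`** (CVZ Cor. 3.31, multiplicativity, `k = 3`):
`F_θ(s ⊗ t) = F_θ(s) F_θ(t)` for every `θ ∈ P([3])` and all complex 3-tensors `s, t` — the proved
super-multiplicativity (Lemma 3.23) and the sub-multiplicativity just discharged.
[cite: ChristandlVranaZuiddam2023, Cor. 3.31] -/
theorem ChristandlVranaZuiddam2023_kronecker_holds : ChristandlVranaZuiddam2023_kronecker.{u} :=
  ChristandlVranaZuiddam2023_kronecker_of_le ChristandlVranaZuiddam2023_kronecker_le_holds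

/-- **`F_θ(s ⊗ t) = F_θ(s) F_θ(t)`**, the multiplicativity of the quantum functional as a plain theorem
(all finite index types in one universe). [cite: ChristandlVranaZuiddam2023, Cor. 3.31] -/
theorem quantumFunctional_kroneckerTensor {θ : Fin 3 → ℝ} (hθ : θ ∈ stdSimplex ℝ (Fin 3))
    {ι κ μ ι' κ' μ' : Type u} [Fintype ι] [Fintype κ] [Fintype μ] [Fintype ι'] [Fintype κ']
    [Fintype μ'] [DecidableEq ι] [DecidableEq κ] [DecidableEq μ] [DecidableEq ι'] [DecidableEq κ']
    [DecidableEq μ'] (s : ι → κ → μ → ℂ) (t : ι' → κ' → μ' → ℂ) :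
    quantumFunctional θ (kroneckerTensor s t) = quantumFunctional θ s * quantumFunctional θ t :=
  ChristandlVranaZuiddam2023_kronecker_holds θ hθ s t

/-- **`E_θ(s ⊗ t) = E_θ(s) + E_θ(t)`** for nonzero `s, t` (logarithmic form of Cor. 3.31).
[cite: ChristandlVranaZuiddam2023, Cor. 3.31] -/
theorem logQuantumFunctional_kroneckerTensor {θ : Fin 3 → ℝ} (hθ : θ ∈ stdSimplex ℝ (Fin 3))
    {ι κ μ ι' κ' μ' : Type u} [Fintype ι] [Fintype κ] [Fintype μ] [Fintype ι'] [Fintype κ']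
    [Fintype μ'] [DecidableEq ι] [DecidableEq κ] [DecidableEq μ] [DecidableEq ι'] [DecidableEq κ']
    [DecidableEq μ'] {s : ι → κ → μ → ℂ} {t : ι' → κ' → μ' → ℂ} (hs : s ≠ 0) (ht : t ≠ 0) :
    logQuantumFunctional θ (kroneckerTensor s t) = logQuantumFunctional θ s + logQuantumFunctional θ t := by
  have hst : kroneckerTensor s t ≠ 0 := kroneckerTensor_ne_zero hs ht
  have h := quantumFunctional_kroneckerTensor hθ s t
  rw [quantumFunctional_of_ne_zero θ hst, quantumFunctional_of_ne_zero θ hs,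
    quantumFunctional_of_ne_zero θ ht, ← Real.rpow_add two_pos] at h
  exact (Real.rpow_right_inj two_pos (by norm_num)).1 h

end Literature.Computability.AlgebraicComplexity

end
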